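import Literature.NumberTheory.EllipticCurves.ComplexMultiplicationLocalFactors16
import Literature.NumberTheory.EllipticCurves.ComplexMultiplicationLocalFactors12
import Literature.NumberTheory.EllipticCurves.ComplexMultiplicationLocalFactors28
import Literature.NumberTheory.EllipticCurves.ComplexMultiplicationLocalFactors27
import Literature.NumberTheory.EllipticCurves.ComplexMultiplicationMaximalOrderProofs
import Literature.NumberTheory.EllipticCurves.ComplexMultiplicationProofs
import Literature.NumberTheory.EllipticCurves.LFunctionSmulProofs
import Mathlib.Data.Nat.Squarefree
import HarnessLib

/-!
# The CM isogeny table with equal `L`-functions; `bsdRankFormula_of_hasCM_of_L_one_ne_zero` from Coates–Wiles and class number one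

Sibling file of `Literature.NumberTheory.EllipticCurves.ComplexMultiplication` (D-0014 append
protocol; everything here is proved, no new definitions). Before this file the target fact
`Literature.NumberTheory.EllipticCurves.bsdRankFormula_of_hasCM_of_L_one_ne_zero` (the Birch–Swinnerton-Dyer rank formula for CM
elliptic curves over `ℚ` with `L(E, 1) ≠ 0`) followed in the tree from exactly three named facts
(`bsdRankFormula_of_hasCM_of_L_one_ne_zero_of_CoatesWiles1977_Knapp_classNumberOne`):
Coates–Wiles 1977, Thm. 1 (`CoatesWiles1977_L_one_eq_zero_of_not_isOfFinAddOrder`), Knapp's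
Thm. 11.67 "isogenous curves over `ℚ` have the same `L`-function"
(`LFunction_eq_of_isIsogenous`) and the classification `hasCM_iff_j_mem` (Heegner–Baker–Stark).
Knapp 11.67 was only used to move `L(E, 1) ≠ 0` across the isogeny from a curve with CM by a
non-maximal order (`j ∈ {54000, 287496, -12288000, 16581375}`) to one with CM by the maximal order.
The files `ComplexMultiplicationLocalFactors12/16/28/27` **prove** that instance of Knapp 11.67 —
equality of Mathlib's `WeierstrassCurve.LFunction` across the four explicit isogeny classes and
all their quadratic twists, prime by prime (Knapp's own sketch at the good primes via
`#E(𝔽_p) = #E'(𝔽_p)`, additive reduction read off the equations at the bad ones, Kraus's condition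
and explicit good models at `p = 2`). This file assembles:

* `Literature.NumberTheory.EllipticCurves.exists_isIsogenous_LFunction_eq_of_j_mem_nonmaximalCMJInvariants_holds`: the tree's
  named fact `exists_isIsogenous_LFunction_eq_of_j_mem_nonmaximalCMJInvariants`
  (`ComplexMultiplicationIsogenyProofs.lean`) **proved** — every elliptic `W / ℚ` with
  `j(W) ∈ nonmaximalCMJInvariants` is isogenous over `ℚ` to an elliptic `W'` with
  `j(W') ∈ maximalCMJInvariants` **and `L(W, s) = L(W', s)`** (`W` is `ℚ`-isomorphic to a twist
  `E_d` of the tabulated model by Silverman X.5.4, `exists_variableChange_eq_quadraticTwist_of_j_eq`;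
  `d = c²n` with `n` a squarefree integer, `Rat.exists_sq_mul_squarefree`; the `L`-function is an
  isomorphism invariant, `LFunction_smul`);
* hence, given only the `only if` half `j_mem_cmJInvariants_of_hasCM` of the classification, the
  isogeny-to-maximal-CM statement *with* equal `L`-functions
  (`exists_isIsogenous_LFunction_eq_of_hasCM_of_j_mem_cmJInvariants_of_hasCM`);
* **`finite_point_of_hasCM_of_L_one_ne_zero` and `bsdRankFormula_of_hasCM_of_L_one_ne_zero` from
  two printed statements**: Coates–Wiles 1977 Thm. 1 and `j_mem_cmJInvariants_of_hasCM`
  (`…_of_CoatesWiles1977_of_j_mem_cmJInvariants_of_hasCM`; with the full `hasCM_iff_j_mem`: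
  `…_of_CoatesWiles1977_classNumberOne`), Knapp 11.67 being discharged for the cases used.

## References

* J. Coates, A. Wiles, *On the conjecture of Birch and Swinnerton-Dyer*, Invent. Math. 39 (1977),
  Thm. 1 (p. 223). [cite: CoatesWiles1977, Thm 1]
* A. W. Knapp, *Elliptic Curves* (1992), Thm. 11.67 (PDF p. 281). [cite: Knapp1993, Thm. 11.67]
* J. H. Silverman, *AEC* 2nd ed. (2009), X.5 Prop. 5.4 / Cor. 5.4.1 (twists), App. C §11
  (C.11.3.1–3.2). [cite: SilvermanAEC2009]
* J. H. Silverman, *Advanced Topics* (1994), II Exercise 2.12(b), App. A §3.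
  [cite: SilvermanAdvancedTopics1994, Exercise 2.12(b) and App. A §3]
-/

noncomputable section

open scoped Classical

open WeierstrassCurve

/-! ## Squarefree normalisation of a rational number -/

/-- **Every non-zero rational number is a rational square times a squarefree integer**:
`d = c² n` with `c ∈ ℚ^*`, `n ∈ ℤ` squarefree (`d = (num·den)/den²` and
`|num·den| = b²a` with `a` squarefree, `Nat.sq_mul_squarefree_of_pos`). [folklore] -/
theorem Rat.exists_sq_mul_squarefree {d : ℚ} (hd : d ≠ 0) :
    ∃ (c : ℚ) (n : ℤ), c ≠ 0 ∧ Squarefree n ∧ d = c ^ 2 * n := by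
  set m : ℤ := d.num * d.den with hm
  have hden : (d.den : ℚ) ≠ 0 := by exact_mod_cast d.den_nz
  have hm0 : m ≠ 0 := mul_ne_zero (Rat.num_ne_zero.mpr hd) (by exact_mod_cast d.den_nz)
  have hdm : d = (m : ℚ) / (d.den : ℚ) ^ 2 := by
    rw [hm, Int.cast_mul, Int.cast_natCast, pow_two, mul_div_mul_right _ _ hden, Rat.num_div_den]
  obtain ⟨a, b, ha, hb, hab, hsq⟩ := Nat.sq_mul_squarefree_of_pos (Int.natAbs_pos.mpr hm0)
  have hb0 : (b : ℚ) ≠ 0 := by exact_mod_cast hb.ne'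
  rcases Int.natAbs_eq m with h | h
  · -- `m = b² a`
    refine ⟨b / d.den, a, div_ne_zero hb0 hden, Int.squarefree_natCast.mpr hsq, ?_⟩
    conv_lhs => rw [hdm, h, ← hab]
    push_cast
    field_simp
  · -- `m = -(b² a)`
    refine ⟨b / d.den, -(a : ℤ), div_ne_zero hb0 hden, ?_, ?_⟩
    · rw [← Int.squarefree_natAbs]; simpa using hsq
    · conv_lhs => rw [hdm, h, ← hab]
      push_cast
      field_simp

namespace WeierstrassCurve

variable {F : Type*} [Field F] (E : WeierstrassCurve F)

/-- Twisting by `c²n` is twisting by `n` up to the `F`-isomorphism `⟨c⁻¹, 0, 0, 0⟩`: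
`E^{(c²n)} = ⟨c, 0, 0, 0⟩⁻¹ • E^{(n)}` (Silverman X.5.4: the twist only depends on
`d mod (F^*)²`). [cite: SilvermanAEC2009, X.5 Prop. 5.4] -/
theorem quadraticTwist_sq_mul {c : F} (hc : c ≠ 0) (n : F) :
    E.quadraticTwist (c ^ 2 * n) = (⟨(Units.mk0 c hc)⁻¹, 0, 0, 0⟩ : VariableChange F) • E.quadraticTwist n := by
  ext
  · simp [variableChange_a₁, quadraticTwist_a₁]
  · simp only [variableChange_a₂, quadraticTwist_a₁, quadraticTwist_a₂, inv_inv, Units.val_mk0]; ring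
  · simp [variableChange_a₃, quadraticTwist_a₁, quadraticTwist_a₃]
  · simp only [variableChange_a₄, quadraticTwist_a₁, quadraticTwist_a₂, quadraticTwist_a₃,
      quadraticTwist_a₄, inv_inv, Units.val_mk0]; ring
  · simp only [variableChange_a₆, quadraticTwist_a₁, quadraticTwist_a₂, quadraticTwist_a₃,
      quadraticTwist_a₄, quadraticTwist_a₆, inv_inv, Units.val_mk0]; ring

/-- Over `ℚ`, the twist of `[0, a, 0, b, c]` by `n` is `[0, na, 0, n²b, n³c]`. [folklore] -/
theorem quadraticTwist_mk (a b c n : ℚ) :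
    (⟨0, a, 0, b, c⟩ : WeierstrassCurve ℚ).quadraticTwist n = ⟨0, n * a, 0, n ^ 2 * b, n ^ 3 * c⟩ := by
  ext <;> simp [quadraticTwist_a₁, quadraticTwist_a₂, quadraticTwist_a₃, quadraticTwist_a₄,
    quadraticTwist_a₆, b₂, b₄, b₆] <;> ring

end WeierstrassCurve

namespace Literature.NumberTheory.EllipticCurves

/-! ## From `j(W)` to a squarefree twist of the tabulated model, with equal `L`-functions -/

/-- **Transport along `j` with `L`-functions.** Let `E / ℚ` be elliptic with `j(E) ≠ 0, 1728`, and
suppose that for every squarefree integer `n` the twist `E^{(n)}` is isogenous over `ℚ` to an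
elliptic curve `F n` with the same `L`-function and `j(F n) = j'`. Then every elliptic `W / ℚ` with
`j(W) = j(E)` is isogenous over `ℚ` to some elliptic `W'` with `L(W, s) = L(W', s)` and
`j(W') = j'`: `W ≅ E^{(d)}` over `ℚ` (Silverman X.5.4), `d = c²n`, `E^{(d)} ≅ E^{(n)}`, and the
`L`-function is an isomorphism invariant (`LFunction_smul`).
[cite: SilvermanAEC2009, X.5 Prop. 5.4 and Cor. 5.4.1] -/
theorem exists_isIsogenous_LFunction_eq_of_j_eq {W E : WeierstrassCurve ℚ} [W.IsElliptic]
    [E.IsElliptic] (hj : W.j = E.j) (h0 : E.j ≠ 0) (h1728 : E.j ≠ 1728) {j' : ℚ}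
    (F : ℤ → WeierstrassCurve ℚ)
    (hF : ∀ n : ℤ, n ≠ 0 → Squarefree n → ∃ (_ : (F n).IsElliptic),
      IsIsogenous (E.quadraticTwist n) (F n) ∧ (E.quadraticTwist n).LFunction = (F n).LFunction ∧
        (F n).j = j') :
    ∃ (W' : WeierstrassCurve ℚ) (_ : W'.IsElliptic),
      IsIsogenous W W' ∧ W.LFunction = W'.LFunction ∧ W'.j = j' := by
  obtain ⟨d, hd, C, hC⟩ := exists_variableChange_eq_quadraticTwist_of_j_eq hj h0 h1728
  obtain ⟨c, n, hc, hsq, rfl⟩ := Rat.exists_sq_mul_squarefree hd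
  have hn : n ≠ 0 := hsq.ne_zero
  have hnQ : (n : ℚ) ≠ 0 := Int.cast_ne_zero.mpr hn
  obtain ⟨hFell, hiso, hL, hjF⟩ := hF n hn hsq
  haveI := E.isElliptic_quadraticTwist hnQ
  rw [E.quadraticTwist_sq_mul hc] at hC
  -- `W = C⁻¹ • C' • E^{(n)}`
  have hW : W = C⁻¹ • ((⟨(Units.mk0 c hc)⁻¹, 0, 0, 0⟩ : VariableChange ℚ) • E.quadraticTwist n) := by
    rw [← hC, inv_smul_smul]
  refine ⟨F n, hFell, ?_, ?_, hjF⟩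
  · have h1 : IsIsogenous W (C • W) := isIsogenous_smul W C
    rw [hC] at h1
    exact h1.trans' ((isIsogenous_of_smul _ _).trans' hiso)
  · rw [← hL, ← LFunction_smul W C, hC, LFunction_smul]

/-! ## The four classes -/

/-- `j = 54000`: isogenous to `j = 0` with the same `L`-function. [cite: Knapp1993, Thm. 11.67] -/
theorem exists_isIsogenous_LFunction_eq_cm12 (W : WeierstrassCurve ℚ) [W.IsElliptic]
    (hj : W.j = 54000) :
    ∃ (W' : WeierstrassCurve ℚ) (_ : W'.IsElliptic),
      IsIsogenous W W' ∧ W.LFunction = W'.LFunction ∧ W'.j = 0 := by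
  refine exists_isIsogenous_LFunction_eq_of_j_eq (E := ⟨0, 6, 0, -3, 0⟩) (by rw [hj, j_cm12])
    (by rw [j_cm12]; norm_num) (by rw [j_cm12]; norm_num)
    (fun n ↦ (⟨0, -3, 0, 3, 0⟩ : WeierstrassCurve ℚ).quadraticTwist n) fun n hn hsq ↦ ?_
  have htw : (⟨0, 6, 0, -3, 0⟩ : WeierstrassCurve ℚ).quadraticTwist n =
      (cm12Model n).map (Int.castRingHom ℚ) := by
    rw [quadraticTwist_mk, map_cm12Model]; ext <;> simp [mul_comm]
  have htw' : (cm12Codomain n).map (Int.castRingHom ℚ) =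
      (⟨0, -3, 0, 3, 0⟩ : WeierstrassCurve ℚ).quadraticTwist n := by
    rw [quadraticTwist_mk, map_cm12Codomain]; ext <;> simp [mul_comm]
  obtain ⟨hiso, hL⟩ := isIsogenous_and_LFunction_eq_cm12 hn hsq
  rw [← htw, htw'] at hiso hL
  have hnQ : (n : ℚ) ≠ 0 := Int.cast_ne_zero.mpr hn
  haveI hF' : (⟨0, -3, 0, 3, 0⟩ : WeierstrassCurve ℚ).IsElliptic :=
    (isElliptic_mk_twoTorsion_iff _ _).mpr (by norm_num)
  haveI := (⟨0, -3, 0, 3, 0⟩ : WeierstrassCurve ℚ).isElliptic_quadraticTwist hnQ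
  refine ⟨inferInstance, hiso, hL, ?_⟩
  rw [j_quadraticTwist _ hnQ, j_mk_twoTorsion]
  norm_num

/-- `j = 287496`: isogenous to `j = 1728` with the same `L`-function. [cite: Knapp1993, Thm. 11.67] -/
theorem exists_isIsogenous_LFunction_eq_cm16 (W : WeierstrassCurve ℚ) [W.IsElliptic]
    (hj : W.j = 287496) :
    ∃ (W' : WeierstrassCurve ℚ) (_ : W'.IsElliptic),
      IsIsogenous W W' ∧ W.LFunction = W'.LFunction ∧ W'.j = 1728 := by
  refine exists_isIsogenous_LFunction_eq_of_j_eq (E := ⟨0, -6, 0, 1, 0⟩) (by rw [hj, j_cm16])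
    (by rw [j_cm16]; norm_num) (by rw [j_cm16]; norm_num)
    (fun n ↦ (⟨0, 3, 0, 2, 0⟩ : WeierstrassCurve ℚ).quadraticTwist n) fun n hn hsq ↦ ?_
  have htw : (⟨0, -6, 0, 1, 0⟩ : WeierstrassCurve ℚ).quadraticTwist n =
      (cm16Model n).map (Int.castRingHom ℚ) := by
    rw [quadraticTwist_mk, map_cm16Model]; ext <;> simp [mul_comm]
  have htw' : (cm16Codomain n).map (Int.castRingHom ℚ) =
      (⟨0, 3, 0, 2, 0⟩ : WeierstrassCurve ℚ).quadraticTwist n := by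
    rw [quadraticTwist_mk, map_cm16Codomain]; ext <;> simp [mul_comm]
  obtain ⟨hiso, hL⟩ := isIsogenous_and_LFunction_eq_cm16 hn hsq
  rw [← htw, htw'] at hiso hL
  have hnQ : (n : ℚ) ≠ 0 := Int.cast_ne_zero.mpr hn
  haveI hF' : (⟨0, 3, 0, 2, 0⟩ : WeierstrassCurve ℚ).IsElliptic :=
    (isElliptic_mk_twoTorsion_iff _ _).mpr (by norm_num)
  haveI := (⟨0, 3, 0, 2, 0⟩ : WeierstrassCurve ℚ).isElliptic_quadraticTwist hnQ
  refine ⟨inferInstance, hiso, hL, ?_⟩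
  rw [j_quadraticTwist _ hnQ, j_mk_twoTorsion]
  norm_num

/-- `j = 16581375`: isogenous to `j = -3375` with the same `L`-function. [cite: Knapp1993, Thm. 11.67] -/
theorem exists_isIsogenous_LFunction_eq_cm28 (W : WeierstrassCurve ℚ) [W.IsElliptic]
    (hj : W.j = 16581375) :
    ∃ (W' : WeierstrassCurve ℚ) (_ : W'.IsElliptic),
      IsIsogenous W W' ∧ W.LFunction = W'.LFunction ∧ W'.j = -3375 := by
  refine exists_isIsogenous_LFunction_eq_of_j_eq (E := ⟨0, -42, 0, -7, 0⟩) (by rw [hj, j_cm28])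
    (by rw [j_cm28]; norm_num) (by rw [j_cm28]; norm_num)
    (fun n ↦ (⟨0, 21, 0, 112, 0⟩ : WeierstrassCurve ℚ).quadraticTwist n) fun n hn hsq ↦ ?_
  have htw : (⟨0, -42, 0, -7, 0⟩ : WeierstrassCurve ℚ).quadraticTwist n =
      (cm28Model n).map (Int.castRingHom ℚ) := by
    rw [quadraticTwist_mk, map_cm28Model]; ext <;> simp [mul_comm]
  have htw' : (cm28Codomain n).map (Int.castRingHom ℚ) =
      (⟨0, 21, 0, 112, 0⟩ : WeierstrassCurve ℚ).quadraticTwist n := by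
    rw [quadraticTwist_mk, map_cm28Codomain]; ext <;> simp [mul_comm]
  obtain ⟨hiso, hL⟩ := isIsogenous_and_LFunction_eq_cm28 hn hsq
  rw [← htw, htw'] at hiso hL
  have hnQ : (n : ℚ) ≠ 0 := Int.cast_ne_zero.mpr hn
  haveI hF' : (⟨0, 21, 0, 112, 0⟩ : WeierstrassCurve ℚ).IsElliptic :=
    (isElliptic_mk_twoTorsion_iff _ _).mpr (by norm_num)
  haveI := (⟨0, 21, 0, 112, 0⟩ : WeierstrassCurve ℚ).isElliptic_quadraticTwist hnQ
  refine ⟨inferInstance, hiso, hL, ?_⟩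
  rw [j_quadraticTwist _ hnQ, j_mk_twoTorsion]
  norm_num

/-- `j = -12288000`: isogenous to `j = 0` with the same `L`-function. [cite: Knapp1993, Thm. 11.67] -/
theorem exists_isIsogenous_LFunction_eq_cm27 (W : WeierstrassCurve ℚ) [W.IsElliptic]
    (hj : W.j = -12288000) :
    ∃ (W' : WeierstrassCurve ℚ) (_ : W'.IsElliptic),
      IsIsogenous W W' ∧ W.LFunction = W'.LFunction ∧ W'.j = 0 := by
  have hE : threeTorsionModel (6 : ℚ) (-4) = ⟨0, 36, 0, -48, 16⟩ := threeTorsionModel_cm27_eq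
  haveI : (⟨0, 36, 0, -48, 16⟩ : WeierstrassCurve ℚ).IsElliptic := hE ▸ inferInstance
  have hjE : (⟨0, 36, 0, -48, 16⟩ : WeierstrassCurve ℚ).j = -12288000 := by
    rw [← j_threeTorsionModel_cm27]; congr 1; exact hE.symm
  refine exists_isIsogenous_LFunction_eq_of_j_eq (E := ⟨0, 36, 0, -48, 16⟩) (by rw [hj, hjE])
    (by rw [hjE]; norm_num) (by rw [hjE]; norm_num)
    (fun n ↦ (cm27Codomain n).map (Int.castRingHom ℚ)) fun n hn hsq ↦ ?_
  have htw : (⟨0, 36, 0, -48, 16⟩ : WeierstrassCurve ℚ).quadraticTwist n =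
      (cm27Model n).map (Int.castRingHom ℚ) := by
    rw [quadraticTwist_mk, map_cm27Model]; ext <;> simp [mul_comm]
  obtain ⟨hiso, hL⟩ := isIsogenous_and_LFunction_eq_cm27 hn hsq
  haveI hF := isElliptic_cm27Codomain_map (d := n) hn
  refine ⟨hF, htw ▸ hiso, htw ▸ hL, ?_⟩
  -- `j = c₄³ / Δ` with `c₄ = 0`
  rw [WeierstrassCurve.j, map_c₄, cm27Codomain_c₄]
  simp

/-- **The CM isogeny table with equal `L`-functions — the named fact
`exists_isIsogenous_LFunction_eq_of_j_mem_nonmaximalCMJInvariants` PROVED.** Every elliptic curve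
over `ℚ` with `j ∈ {54000, 287496, -12288000, 16581375}` (CM by a non-maximal order) is isogenous
over `ℚ` to an elliptic curve with `j ∈ maximalCMJInvariants` (namely `0, 1728, 0, -3375`)
**having the same `L`-function** — Silverman, *Advanced Topics*, Exercise 2.12(b), together with
Knapp's Theorem 11.67 *proved* for these four isogeny classes and all their twists
(`ComplexMultiplicationLocalFactors12/16/28/27`). Strengthens the tree's
`exists_isIsogenous_j_mem_maximalCMJInvariants_of_j_mem_nonmaximalCMJInvariants_holds`.
[cite: SilvermanAdvancedTopics1994, Exercise 2.12(b) and App. A §3] [cite: Knapp1993, Thm. 11.67] -/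
theorem exists_isIsogenous_LFunction_eq_of_j_mem_nonmaximalCMJInvariants_holds :
    exists_isIsogenous_LFunction_eq_of_j_mem_nonmaximalCMJInvariants := by
  intro W _ hj
  simp only [nonmaximalCMJInvariants, Finset.mem_insert, Finset.mem_singleton] at hj
  rcases hj with hj | hj | hj | hj
  · obtain ⟨W', hW', hiso, hL, hjW'⟩ := exists_isIsogenous_LFunction_eq_cm12 W hj
    exact ⟨W', hW', hiso, by rw [hjW']; decide, hL⟩
  · obtain ⟨W', hW', hiso, hL, hjW'⟩ := exists_isIsogenous_LFunction_eq_cm16 W hj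
    exact ⟨W', hW', hiso, by rw [hjW']; decide, hL⟩
  · obtain ⟨W', hW', hiso, hL, hjW'⟩ := exists_isIsogenous_LFunction_eq_cm27 W hj
    exact ⟨W', hW', hiso, by rw [hjW']; decide, hL⟩
  · obtain ⟨W', hW', hiso, hL, hjW'⟩ := exists_isIsogenous_LFunction_eq_cm28 W hj
    exact ⟨W', hW', hiso, by rw [hjW']; decide, hL⟩

/-- **Isogeny to maximal CM with equal `L`-functions, for the thirteen CM `j`-invariants.**
Every elliptic `W / ℚ` with `j(W) ∈ cmJInvariants` is isogenous over `ℚ` to an elliptic curve with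
`j ∈ maximalCMJInvariants` and the same `L`-function (identity isogeny if `j(W)` is already a
maximal-order value; the table otherwise) — unconditionally.
[cite: SilvermanAdvancedTopics1994, Exercise 2.12(b)] [cite: Knapp1993, Thm. 11.67] -/
theorem exists_isIsogenous_LFunction_eq_of_j_mem_cmJInvariants
    (W : WeierstrassCurve ℚ) [W.IsElliptic] (hW : W.j ∈ cmJInvariants) :
    ∃ (W' : WeierstrassCurve ℚ) (_ : W'.IsElliptic),
      IsIsogenous W W' ∧ W'.j ∈ maximalCMJInvariants ∧ W.LFunction = W'.LFunction := by
  by_cases hmax : W.j ∈ maximalCMJInvariants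
  · exact ⟨W, ‹W.IsElliptic›, isIsogenous_self W, hmax, rfl⟩
  · exact exists_isIsogenous_LFunction_eq_of_j_mem_nonmaximalCMJInvariants_holds W
      (mem_nonmaximalCMJInvariants_iff.2 ⟨hW, hmax⟩)

/-- **Isogeny to maximal CM with equal `L`-functions, from the `only if` half of the
classification alone.** Given `j_mem_cmJInvariants_of_hasCM` (Silverman *AEC* C.11.3.1–3.2,
Heegner–Baker–Stark), every CM elliptic curve over `ℚ` is isogenous over `ℚ` to an elliptic curve
with CM by the maximal order and the same `L`-function
(`forall_hasCM_exists_isIsogenous_LFunction_eq` with the table fact discharged).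
[cite: SilvermanAdvancedTopics1994, Exercise 2.12(b)] [cite: Knapp1993, Thm. 11.67] -/
theorem exists_isIsogenous_LFunction_eq_of_hasCM_of_j_mem_cmJInvariants_of_hasCM
    (h₁ : j_mem_cmJInvariants_of_hasCM) (W : WeierstrassCurve ℚ) [W.IsElliptic] (hCM : W.HasCM) :
    ∃ (W' : WeierstrassCurve ℚ) (_ : W'.IsElliptic),
      IsIsogenous W W' ∧ W'.j ∈ maximalCMJInvariants ∧ W.LFunction = W'.LFunction :=
  forall_hasCM_exists_isIsogenous_LFunction_eq h₁
    exists_isIsogenous_LFunction_eq_of_j_mem_nonmaximalCMJInvariants_holds W hCM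

/-! ## The CM finiteness fact and the target fact from Coates–Wiles and class number one -/

/-- **`finite_point_of_hasCM_of_L_one_ne_zero` from Coates–Wiles and the `only if` half of the
classification.** If `E / ℚ` has complex multiplication and `L(E, 1) ≠ 0` then `E(ℚ)` is finite —
from Coates–Wiles 1977, Thm. 1 as printed (`hCW`; with Mordell–Weil, proved in the tree) and only
the implication "`E` has CM `⟹ j(E)` is one of the thirteen class-number-one values"
(`h₁ : j_mem_cmJInvariants_of_hasCM`, Silverman *AEC* C.11.3.1–3.2, Heegner–Baker–Stark): the
third hypothesis `h4L` of the tree's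
`finite_point_of_hasCM_of_L_one_ne_zero_of_CoatesWiles1977_of_j_mem_of_table_LFunction` — the
isogeny table *with* equal `L`-functions, i.e. Knapp's Thm. 11.67 for the four classes — is
discharged by `exists_isIsogenous_LFunction_eq_of_j_mem_nonmaximalCMJInvariants_holds`.
[cite: CoatesWiles1977, Thm 1 (p. 223)] [cite: SilvermanAEC2009, App. C §11, Example 11.3.1–11.3.2] -/
theorem finite_point_of_hasCM_of_L_one_ne_zero_of_CoatesWiles1977_of_j_mem_cmJInvariants_of_hasCM
    (hCW : CoatesWiles1977_L_one_eq_zero_of_not_isOfFinAddOrder)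
    (h₁ : j_mem_cmJInvariants_of_hasCM) : finite_point_of_hasCM_of_L_one_ne_zero :=
  finite_point_of_hasCM_of_L_one_ne_zero_of_CoatesWiles1977_of_j_mem_of_table_LFunction hCW h₁
    exists_isIsogenous_LFunction_eq_of_j_mem_nonmaximalCMJInvariants_holds

/-- **`finite_point_of_hasCM_of_L_one_ne_zero` from two printed statements**: Coates–Wiles 1977,
Thm. 1 (`hCW`) and the classification `hasCM_iff_j_mem` (`h13`), of which only the `only if`
direction is used (`…_of_CoatesWiles1977_of_j_mem_cmJInvariants_of_hasCM`).
[cite: CoatesWiles1977, Thm 1 (p. 223)] -/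
theorem finite_point_of_hasCM_of_L_one_ne_zero_of_CoatesWiles1977_classNumberOne
    (hCW : CoatesWiles1977_L_one_eq_zero_of_not_isOfFinAddOrder) (h13 : hasCM_iff_j_mem) :
    finite_point_of_hasCM_of_L_one_ne_zero :=
  finite_point_of_hasCM_of_L_one_ne_zero_of_CoatesWiles1977_of_j_mem_cmJInvariants_of_hasCM hCW
    (j_mem_cmJInvariants_of_hasCM_of_hasCM_iff_j_mem h13)

/-- **The target fact `bsdRankFormula_of_hasCM_of_L_one_ne_zero` from Coates–Wiles and the
`only if` half of the classification.** The Birch–Swinnerton-Dyer rank formula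
`r_an(E) = rank E(ℚ)` (`= 0`) for elliptic curves over `ℚ` with complex multiplication and
`L(E, 1) ≠ 0` follows, sorry-free, from exactly two named facts, both printed statements:
Coates–Wiles 1977, Theorem 1 (`hCW`) and "CM `⟹ j ∈ cmJInvariants`"
(`h₁ : j_mem_cmJInvariants_of_hasCM`, Silverman *AEC* C.11.3.1–3.2, Heegner–Baker–Stark);
Mordell–Weil, the analytic-rank glue, the isogeny to maximal CM, the finiteness descent *and
Knapp's Theorem 11.67 for the four CM isogeny classes and their twists* are all proved in the
tree. [cite: CoatesWiles1977, Thm 1 (p. 223)]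
[cite: SilvermanAEC2009, App. C §11, Example 11.3.1–11.3.2] -/
theorem bsdRankFormula_of_hasCM_of_L_one_ne_zero_of_CoatesWiles1977_of_j_mem_cmJInvariants_of_hasCM
    (hCW : CoatesWiles1977_L_one_eq_zero_of_not_isOfFinAddOrder)
    (h₁ : j_mem_cmJInvariants_of_hasCM) : bsdRankFormula_of_hasCM_of_L_one_ne_zero :=
  bsdRankFormula_of_hasCM_of_L_one_ne_zero_of_CoatesWiles1977_of_j_mem_of_table_LFunction hCW h₁
    exists_isIsogenous_LFunction_eq_of_j_mem_nonmaximalCMJInvariants_holds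

/-- **The target fact `bsdRankFormula_of_hasCM_of_L_one_ne_zero` from two printed statements**:
Coates–Wiles 1977, Theorem 1 (`hCW`) and the classification of rational CM `j`-invariants
`hasCM_iff_j_mem` (`h13`); compare the tree's
`bsdRankFormula_of_hasCM_of_L_one_ne_zero_of_CoatesWiles1977_Knapp_classNumberOne`, whose
hypothesis Knapp 11.67 (`LFunction_eq_of_isIsogenous`) is discharged here for the cases used.
[cite: CoatesWiles1977, Thm 1 (p. 223)] -/
theorem bsdRankFormula_of_hasCM_of_L_one_ne_zero_of_CoatesWiles1977_classNumberOne
    (hCW : CoatesWiles1977_L_one_eq_zero_of_not_isOfFinAddOrder) (h13 : hasCM_iff_j_mem) :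
    bsdRankFormula_of_hasCM_of_L_one_ne_zero :=
  bsdRankFormula_of_hasCM_of_L_one_ne_zero_of_CoatesWiles1977_of_j_mem_cmJInvariants_of_hasCM hCW
    (j_mem_cmJInvariants_of_hasCM_of_hasCM_iff_j_mem h13)

end Literature.NumberTheory.EllipticCurves
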